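import Summits.CriticalPhenomena.CardyFormulaZ2.Theorems.CardySusyWardParafermionFamiliesToSLESixHalfCRVertexRelationLoop
import Summits.CriticalPhenomena.CardyFormulaZ2.Theorems.CardySusyWardParafermionFamiliesToSLESixHalfCRVertexRelationPairing

/-!
# The half-CR combination is odd under toggling the edge (stub S2, part 3)

Helper file for the crux `CardySusyWard.ParafermionFamiliesToSLESix` (stmt-CriticalPhenomena-10814),
line `strip-anchored-vertex-normalisation`, stub `stub_halfCRVertexRelation` (S2).  Combines the
orientation lemma (part 1, `S2.loopTurn_eq`) with the pair identity (part 2, `S2.gval_case1`,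
`S2.gval_case0`) into the pathwise statement behind Duminil-Copin 2012, Prop. 4 at `q = 1`:

**Theorem** (`gval_add_gval_toggle`).  For admissible Dobrushin data with hole-free inner faces, an
edge `e = cTgt p` all of whose endpoints' faces are inner and none of whose endpoints lies on the arc
`B`, and two configurations whose completions agree off `e` and differ at `e`, the half-CR
combinations `g` (`S2.gval`, read along the two explorations from the start corner to the exit time)
are opposite: `g(ω) + g(ω') = 0`.

Proof: classify `ω` by which of the two corners `p`, `p₂` arriving at `e` are darts of its
exploration.  None: none for `ω'` either (`cornerOrbit_toggle_case0`), both `g` vanish.  Exactly one: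
`gval_case1` from that side, the loop of the other corner being inner and off the interface
(`cornerOrbit_toggle_case1`) and correctly oriented (`loopTurn_eq`).  Both: then exactly one for `ω'`
(`cornerOrbit_toggle_case2`: the stretch between the two visits is excised), and `gval_case1` applies
from the side of `ω'`.
-/

noncomputable section

namespace Summit.CriticalPhenomena.CardyFormulaZ2.Theorems.ParafermionFamiliesToSLESix.StripAnchored

open Finset Complex
open Literature.Probability.Percolation (BondConfig)
open Literature.Probability.LatticeModels
open Literature.Probability.LatticeModels.DiscreteDobrushin (startCorner exitTime isStartCorner_startCorner
  not_isInnerFace_exitTime isInnerFace_of_lt_exitTime)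

namespace S2

variable {D : DiscreteDobrushin}

/-! ## One side arrives along exactly one corner -/

/-- **Exactly one arriving corner on the side of `ω`.** If `p` is a dart of the exploration of `ω`
(before the exit) and its partner is not, then `g(ω) + g(ω') = 0` for every `ω'` whose completion is
that of `ω` toggled at `e = cTgt p` (hole-free inner faces, `e` interior).
[cite: DuminilCopin2012Parafermion, Proposition 4] -/
theorem gval_add_of_one (hD : D.IsZdAdmissible) (hH : HoleFree {f : Site 2 | D.IsInnerFace f})
    {p : Site 2 × Fin 4} (hx : ∀ j, D.IsInnerFace (faceAt p.1 j))
    (hy : ∀ j, D.IsInnerFace (faceAt (p.1 + cornerUnit (p.2 + 1)) j)) (hB : ∀ x ∈ cTgt p, x ∉ D.zdArcB)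
    {ω ω' : BondConfig (Site 2)}
    (hagree : ∀ e, e ≠ cTgt p → (e ∈ D.bcBondConfig ω' ↔ e ∈ D.bcBondConfig ω))
    (hdiff : ¬ (cTgt p ∈ D.bcBondConfig ω' ↔ cTgt p ∈ D.bcBondConfig ω))
    (h₁ : ∃ i < exitTime hD ω, cornerOrbit (D.bcBondConfig ω) (startCorner hD) i = p)
    (h₂ : ∀ i < exitTime hD ω, cornerOrbit (D.bcBondConfig ω) (startCorner hD) i ≠ cornerPartner p) :
    gval (D.bcBondConfig ω) (startCorner hD) p (exitTime hD ω) +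
      gval (D.bcBondConfig ω') (startCorner hD) p (exitTime hD ω') = 0 := by
  set c₀ := startCorner hD with hc₀def
  have hc₀ : D.IsStartCorner c₀ := isStartCorner_startCorner hD
  set β := D.bcBondConfig ω with hβ
  set β' := D.bcBondConfig ω' with hβ'
  set N := exitTime hD ω with hNdef
  have hN : ¬ D.IsInnerFace (cFace (cornerOrbit β c₀ N)) := not_isInnerFace_exitTime hD _
  have hlt : ∀ k < N, D.IsInnerFace (cFace (cornerOrbit β c₀ k)) := fun k hk => isInnerFace_of_lt_exitTime hD _ hk
  obtain ⟨i₁, hi₁N, hi₁⟩ := h₁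
  -- period data of the interface cycle and of the loop of the partner
  have hc₀m : c₀.1 ∈ meshDomain D.Ω D.δ := D.zdBoundary_subset_meshDomain (D.zdArcA_subset_zdBoundary hc₀.mem_zdArcA)
  obtain ⟨P, hP0, hP, hPmin⟩ := exists_min_period hD ω hc₀m
  have hym : (cornerPartner p).1 ∈ meshDomain D.Ω D.δ := fst_mem_meshDomain_of_isInnerFace (hy (cornerPartner p).2)
  obtain ⟨Q, hQ0, hQ, hQmin⟩ := exists_min_period hD ω hym
  -- the loop is inner and off the interface
  have hdisj : ∀ m s, cornerOrbit β (cornerPartner p) m ≠ cornerOrbit β c₀ s := fun m s =>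
    loop_ne_of_never_arrives hD hc₀ hy hN hlt hP0 hP hPmin h₂ m s
  obtain ⟨-, hloop, -, hin', hout'⟩ := cornerOrbit_toggle_case1 hD hc₀ hagree hdiff hx hy hN hlt hP0 hP hPmin hQ0 hQ
    hQmin hi₁ hi₁N h₂
  have hLin : ∀ m, D.IsInnerFace (cFace (cornerOrbit β (cornerPartner p) m)) := by
    intro m
    rw [← cornerOrbit_mod_period hQ m]
    rcases Nat.eq_zero_or_pos (m % Q) with h0 | hpos
    · rw [h0]; exact hy (cornerPartner p).2
    · have hmQ : m % Q < Q := Nat.mod_lt _ hQ0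
      have := hloop (m % Q - 1) (by omega)
      rw [Nat.sub_add_cancel hpos] at this
      rw [← this]
      exact hin' _ (by omega)
  -- orientation of the loop, and the pair identity
  have hS := loopTurn_eq hH hc₀ hx hN hQ0 hQ hQmin hLin (fun m i _ => hdisj m i) hi₁ hi₁N
  have hpair := gval_case1 hD hc₀ hagree hdiff hB hx hy hN hlt hP0 hP hPmin hQ0 hQ hQmin hi₁ hi₁N h₂ hS
  rwa [← exitTime_eq_of hD ω' hout' hin'] at hpair

/-! ## The involution -/

/-- Under toggling, "both corners arrive, `p` first" becomes "only `p` arrives".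
[cite: Smirnov2010, proof of Lemma 4.5] -/
theorem one_of_both (hD : D.IsZdAdmissible) {p : Site 2 × Fin 4} {ω ω' : BondConfig (Site 2)}
    (hagree : ∀ e, e ≠ cTgt p → (e ∈ D.bcBondConfig ω' ↔ e ∈ D.bcBondConfig ω))
    (hdiff : ¬ (cTgt p ∈ D.bcBondConfig ω' ↔ cTgt p ∈ D.bcBondConfig ω)) {i₁ i₂ : ℕ}
    (hi₁ : cornerOrbit (D.bcBondConfig ω) (startCorner hD) i₁ = p)
    (hi₂ : cornerOrbit (D.bcBondConfig ω) (startCorner hD) i₂ = cornerPartner p) (h12 : i₁ < i₂)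
    (hi₂N : i₂ < exitTime hD ω) :
    (∃ i < exitTime hD ω', cornerOrbit (D.bcBondConfig ω') (startCorner hD) i = p) ∧
      ∀ i < exitTime hD ω', cornerOrbit (D.bcBondConfig ω') (startCorner hD) i ≠ cornerPartner p := by
  set c₀ := startCorner hD with hc₀def
  have hc₀ : D.IsStartCorner c₀ := isStartCorner_startCorner hD
  set N := exitTime hD ω with hNdef
  have hN : ¬ D.IsInnerFace (cFace (cornerOrbit (D.bcBondConfig ω) c₀ N)) := not_isInnerFace_exitTime hD _
  have hlt : ∀ k < N, D.IsInnerFace (cFace (cornerOrbit (D.bcBondConfig ω) c₀ k)) := fun k hk =>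
    isInnerFace_of_lt_exitTime hD _ hk
  have hinj : ∀ a b, a < N → b < N → cornerOrbit (D.bcBondConfig ω) c₀ a = cornerOrbit (D.bcBondConfig ω) c₀ b → a = b := by
    intro a b ha hb h
    by_contra hne
    rcases Nat.lt_or_gt_of_ne hne with hab | hab
    · exact cornerOrbit_ne hD hc₀ hab (fun k hk => hlt k (by omega)) h
    · exact cornerOrbit_ne hD hc₀ hab (fun k hk => hlt k (by omega)) h.symm
  obtain ⟨hpre, htail⟩ := cornerOrbit_toggle_case2 hD hc₀ hagree hdiff hlt hi₁ hi₂ h12 hi₂N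
  obtain ⟨hout', hin'⟩ := exit_toggle_case2 hD hc₀ hagree hdiff hN hlt hi₁ hi₂ h12 hi₂N
  have hN' : exitTime hD ω' = N - (i₂ - i₁) := exitTime_eq_of hD ω' hout' hin'
  rw [hN']
  refine ⟨⟨i₁, by omega, by rw [hpre i₁ le_rfl, hi₁]⟩, fun j hj h => ?_⟩
  by_cases hji : j ≤ i₁
  · rw [hpre j hji] at h
    have := hinj j i₂ (by omega) hi₂N (h.trans hi₂.symm); omega
  · have ht := htail (j - i₁ - 1) (by omega)
    rw [show i₁ + 1 + (j - i₁ - 1) = j by omega] at ht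
    rw [ht] at h
    have := hinj _ i₂ (by omega) hi₂N (h.trans hi₂.symm); omega

/-- **The half-CR combination is odd under toggling `e`.** For admissible Dobrushin data with
hole-free inner faces, an edge `e = cTgt p` all of whose endpoints' faces are inner and with no
endpoint on the arc `B`, and configurations `ω`, `ω'` whose completions agree off `e` and differ at
`e`: `g(ω) + g(ω') = 0` (`g` = `S2.gval` along the exploration, from the start corner to the exit).
[cite: DuminilCopin2012Parafermion, Proposition 4] [cite: DuminilCopinSmirnov2012Lattice, Proposition 8.6] -/
theorem gval_add_gval_toggle (hD : D.IsZdAdmissible) (hH : HoleFree {f : Site 2 | D.IsInnerFace f})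
    {p : Site 2 × Fin 4} (hx : ∀ j, D.IsInnerFace (faceAt p.1 j))
    (hy : ∀ j, D.IsInnerFace (faceAt (p.1 + cornerUnit (p.2 + 1)) j)) (hB : ∀ x ∈ cTgt p, x ∉ D.zdArcB)
    {ω ω' : BondConfig (Site 2)}
    (hagree : ∀ e, e ≠ cTgt p → (e ∈ D.bcBondConfig ω' ↔ e ∈ D.bcBondConfig ω))
    (hdiff : ¬ (cTgt p ∈ D.bcBondConfig ω' ↔ cTgt p ∈ D.bcBondConfig ω)) :
    gval (D.bcBondConfig ω) (startCorner hD) p (exitTime hD ω) +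
      gval (D.bcBondConfig ω') (startCorner hD) p (exitTime hD ω') = 0 := by
  set c₀ := startCorner hD with hc₀def
  have hc₀ : D.IsStartCorner c₀ := isStartCorner_startCorner hD
  set N := exitTime hD ω with hNdef
  have hN : ¬ D.IsInnerFace (cFace (cornerOrbit (D.bcBondConfig ω) c₀ N)) := not_isInnerFace_exitTime hD _
  have hlt : ∀ k < N, D.IsInnerFace (cFace (cornerOrbit (D.bcBondConfig ω) c₀ k)) := fun k hk =>
    isInnerFace_of_lt_exitTime hD _ hk
  -- the symmetric forms of the hypotheses (swap `ω ↔ ω'`, `p ↔ p₂`)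
  have hagree' : ∀ e, e ≠ cTgt p → (e ∈ D.bcBondConfig ω ↔ e ∈ D.bcBondConfig ω') := fun e he => (hagree e he).symm
  have hdiff' : ¬ (cTgt p ∈ D.bcBondConfig ω ↔ cTgt p ∈ D.bcBondConfig ω') := fun h => hdiff h.symm
  have hyx : (cornerPartner p).1 + cornerUnit ((cornerPartner p).2 + 1) = p.1 := by
    change p.1 + cornerUnit (p.2 + 1) + cornerUnit (p.2 + 2 + 1) = p.1
    rw [show p.2 + 2 + 1 = (p.2 + 1) + 2 by omega, cornerUnit_add_two]; abel
  have hx₂ : ∀ j, D.IsInnerFace (faceAt (cornerPartner p).1 j) := hy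
  have hy₂ : ∀ j, D.IsInnerFace (faceAt ((cornerPartner p).1 + cornerUnit ((cornerPartner p).2 + 1)) j) := by
    rw [hyx]; exact hx
  have hB₂ : ∀ x ∈ cTgt (cornerPartner p), x ∉ D.zdArcB := by rw [cTgt_partner]; exact hB
  have hagree₂ : ∀ e, e ≠ cTgt (cornerPartner p) → (e ∈ D.bcBondConfig ω' ↔ e ∈ D.bcBondConfig ω) := by
    rw [cTgt_partner]; exact hagree
  have hdiff₂ : ¬ (cTgt (cornerPartner p) ∈ D.bcBondConfig ω' ↔ cTgt (cornerPartner p) ∈ D.bcBondConfig ω) := by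
    rw [cTgt_partner]; exact hdiff
  have hagree₂' : ∀ e, e ≠ cTgt (cornerPartner p) → (e ∈ D.bcBondConfig ω ↔ e ∈ D.bcBondConfig ω') :=
    fun e he => (hagree₂ e he).symm
  have hdiff₂' : ¬ (cTgt (cornerPartner p) ∈ D.bcBondConfig ω ↔ cTgt (cornerPartner p) ∈ D.bcBondConfig ω') :=
    fun h => hdiff₂ h.symm
  by_cases h₁ : ∃ i < N, cornerOrbit (D.bcBondConfig ω) c₀ i = p
  · by_cases h₂ : ∃ i < N, cornerOrbit (D.bcBondConfig ω) c₀ i = cornerPartner p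
    · -- both arrive in `ω`: exactly one arrives in `ω'`
      obtain ⟨i₁, hi₁N, hi₁⟩ := h₁
      obtain ⟨i₂, hi₂N, hi₂⟩ := h₂
      have hne : i₁ ≠ i₂ := by rintro rfl; exact partner_ne p (hi₂.symm.trans hi₁)
      rcases Nat.lt_or_gt_of_ne hne with h12 | h12
      · obtain ⟨h₁', h₂'⟩ := one_of_both hD hagree hdiff hi₁ hi₂ h12 hi₂N
        have := gval_add_of_one hD hH hx hy hB hagree' hdiff' h₁' h₂'
        linear_combination this
      · obtain ⟨h₁', h₂'⟩ := one_of_both (p := cornerPartner p) hD hagree₂ hdiff₂ hi₂ (by rw [partner_partner]; exact hi₁)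
          h12 hi₁N
        rw [partner_partner] at h₂'
        have := gval_add_of_one hD hH hx₂ hy₂ hB₂ hagree₂' hdiff₂' h₁' (by rw [partner_partner]; exact h₂')
        rw [gval_partner, gval_partner] at this
        linear_combination -this
    · -- only `p` arrives
      push Not at h₂
      exact gval_add_of_one hD hH hx hy hB hagree hdiff h₁ h₂
  · push Not at h₁
    by_cases h₂ : ∃ i < N, cornerOrbit (D.bcBondConfig ω) c₀ i = cornerPartner p
    · -- only the partner arrives
      have := gval_add_of_one (p := cornerPartner p) hD hH hx₂ hy₂ hB₂ hagree₂ hdiff₂ h₂ (by rw [partner_partner]; exact h₁)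
      rw [gval_partner, gval_partner] at this
      linear_combination -this
    · -- no arrival: the explorations agree
      push Not at h₂
      have hcase := cornerOrbit_toggle_case0 (c₀ := c₀) hagree hdiff h₁ h₂
      have hN' : exitTime hD ω' = N := by
        refine exitTime_eq_of hD _ ?_ fun k hk => ?_
        · rw [hcase N le_rfl]; exact hN
        · rw [hcase k hk.le]; exact hlt k hk
      rw [hN', gval_case0 hc₀ hB h₁ h₂, gval_case0 (ω := ω') hc₀ hB (fun i hi => by rw [hcase i hi.le]; exact h₁ i hi)
        (fun i hi => by rw [hcase i hi.le]; exact h₂ i hi), add_zero]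

end S2

/-- **Registered one-line form of the pathwise oddness** `S2.gval_add_gval_toggle` (sub-goal `stub_halfCR_pathwise`
of stmt-CriticalPhenomena-10814, part 3 of stub S2). [cite: DuminilCopin2012Parafermion, Proposition 4] -/
theorem stub_halfCR_pathwise : ∀ (D : DiscreteDobrushin) (hD : D.IsZdAdmissible) (p : Site 2 × Fin 4) (ω ω' : BondConfig (Site 2)), HoleFree {f : Site 2 | D.IsInnerFace f} → (∀ j, D.IsInnerFace (faceAt p.1 j)) → (∀ j, D.IsInnerFace (faceAt (p.1 + cornerUnit (p.2 + 1)) j)) → (∀ x ∈ cTgt p, x ∉ D.zdArcB) → (∀ e, e ≠ cTgt p → (e ∈ D.bcBondConfig ω' ↔ e ∈ D.bcBondConfig ω)) → ¬ (cTgt p ∈ D.bcBondConfig ω' ↔ cTgt p ∈ D.bcBondConfig ω) → S2.gval (D.bcBondConfig ω) (startCorner hD) p (exitTime hD ω) + S2.gval (D.bcBondConfig ω') (startCorner hD) p (exitTime hD ω') = 0 :=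
  fun _ hD _ _ _ hH hx hy hB hagree hdiff => S2.gval_add_gval_toggle hD hH hx hy hB hagree hdiff

end Summit.CriticalPhenomena.CardyFormulaZ2.Theorems.ParafermionFamiliesToSLESix.StripAnchored

end
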